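import Literature.AlgebraicTopology.FundamentalGroup.OrbitSpaceFundamentalGroup
import Literature.AlgebraicTopology.FundamentalGroup.OrbitMapPathLifting
import HarnessLib

/-!
# Armstrong (1968): discharge of `armstrong1968_orbitSpace_simplyConnected`

M. A. Armstrong, *The fundamental group of the orbit space of a discontinuous group*,
Proc. Cambridge Philos. Soc. **64** (1968), 299–301, Theorem (p. 299): for a discontinuous group
`G` of homeomorphisms of a path connected, simply connected, locally compact metric space `X`,
`π₁(X/G) ≅ G/H`, `H` the (normal) subgroup generated by the elements having a fixed point. The
tree's named fact `armstrong1968_orbitSpace_simplyConnected`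
(`OrbitSpaceFundamentalGroup.lean`) is the case `H = G`, `G` finite: **the orbit space is simply
connected**. It is proved here (`armstrong1968_orbitSpace_simplyConnected_holds`).

## The proof

Armstrong's three pages are paywalled and not held (acquisition request filed 2026-08-15); the
argument formalised is the standard one, printed in R. Brown, *Topology and Groupoids* (2006),
Ch. 11 (11.1.4: path lifting; 11.5.2 (b)–(c) with 11.2.3: the orbit morphism is surjective on
elements and `π₁(X/G) ≅ G/K`, `K` generated by the elements with a fixed point, via the
correction paths `gᵢ • δᵢ - δᵢ` of Fig. 11.2), specialised to `K = G` where no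
semilocal-simple-connectivity hypothesis (Brown's 11.2.2 (b)(ii)) is needed:

1. *Path lifting* (`OrbitMapPathLifting.exists_path_lift`, Brown 11.1.4 = Bredon 1972, II.6.2):
   paths in `X/G` lift to `X` (finite `G`, Hausdorff `X`).
2. *The comparison loops* (`exists_path_map_homotopic_refl`): for every `g` in the subgroup
   generated by the elements with fixed points and every `x ∈ X` there is a path `Δ : x ⟶ g • x`
   whose image in `X/G` is a null-homotopic loop at `p x`. For a generator `g` fixing `z`, take
   `Δ = α · (g • α)⁻¹` with `α : x ⟶ z` (Brown's `g • δ - δ`); its image is `pα · (pα)⁻¹ ≃ const`.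
   Products: concatenate `Δ_h` and `Δ_g` (based at `h • x`); inverses: reverse and translate.
3. *Conclusion* (`simplyConnectedSpace_orbitSpace`): given paths `γ₁, γ₂ : y ⟶ y'` in `X/G`, lift
   both from one point `x₀` over `y`; the endpoints `x₁`, `g • x₁` lie in one orbit. In the simply
   connected `X`, `Γ₂ ≃ Δ · (g • Γ₁)` rel endpoints (`Δ : x₀ ⟶ g • x₀` from step 2); applying `p`,
   `γ₂ ≃ pΔ · γ₁ ≃ const · γ₁ ≃ γ₁`. With path connectedness of `X/G` this is
   `SimplyConnectedSpace (X/G)` (`simply_connected_iff_paths_homotopic'`).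

Only `Finite G`, `T2Space X`, `SimplyConnectedSpace X` and continuity of each `g • ·` are used;
the fact's `MetricSpace`/`LocallyCompactSpace` hypotheses (Armstrong's printed hypotheses) are
not needed by this argument.

## References

* M. A. Armstrong, Proc. Cambridge Philos. Soc. 64 (1968), 299–301, Theorem p. 299.
  [cite: Armstrong1968, Theorem (p. 299)]
* R. Brown, *Topology and Groupoids* (2006), 11.1.4, 11.2.3, 11.5.2. [cite: Brown2006, 11.5.2]
* G. E. Bredon, *Introduction to Compact Transformation Groups* (1972), II.6.2–6.3.
-/

noncomputable section

open Set MulAction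
open scoped Topology unitInterval

namespace Literature.AlgebraicTopology.FundamentalGroup

open OrbitMapPathLifting

namespace OrbitSpaceFundamentalGroup

universe u v

variable {G : Type u} [Group G] {X : Type v} [TopologicalSpace X] [MulAction G X]

/-- The orbit map `X → X/G` is continuous (spelled with `Quotient.mk`). [folklore] -/
theorem continuous_mk : Continuous (Quotient.mk (orbitRel G X)) :=
  continuous_quot_mk

/-- **The comparison loops** (Armstrong 1968; Brown 11.5.2 (b), the paths `gᵢ • δᵢ - δᵢ`): if
`X` is path connected and `g` lies in the subgroup generated by the elements of `G` having a
fixed point, then every `x` is joined to `g • x` by a path whose image in `X/G` is a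
null-homotopic loop. [cite: Armstrong1968, Theorem (p. 299)] -/
theorem exists_path_map_homotopic_refl [ContinuousConstSMul G X] [PathConnectedSpace X] {g : G}
    (hg : g ∈ Subgroup.closure {g : G | ∃ x : X, g • x = x}) :
    ∀ x : X, ∃ Δ : Path x (g • x),
      ((Δ.map (continuous_mk (G := G) (X := X))).cast rfl (mk_smul_eq g x).symm).Homotopic
        (Path.refl (⟦x⟧ : orbitRel.Quotient G X)) := by
  induction hg using Subgroup.closure_induction with
  | mem g hg =>
    obtain ⟨z, hz⟩ := hg
    intro x
    let α : Path x z := PathConnectedSpace.somePath x z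
    refine ⟨α.trans ((α.symm.map (continuous_const_smul g)).cast hz.symm rfl), ?_⟩
    have key : (((α.trans ((α.symm.map (continuous_const_smul g)).cast hz.symm rfl)).map
        (continuous_mk (G := G) (X := X))).cast rfl (mk_smul_eq g x).symm) =
        (α.map (continuous_mk (G := G) (X := X))).trans
          (α.map (continuous_mk (G := G) (X := X))).symm := by
      ext t
      simp only [Path.cast_coe, Path.map_coe, Function.comp_apply, Path.trans_apply,
        Path.map_symm]
      split_ifs with h
      · rfl
      · exact mk_smul_eq g _
    rw [key]
    exact ⟨(Path.Homotopy.reflTransSymm _).symm⟩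
  | one =>
    intro x
    refine ⟨(Path.refl x).cast rfl (one_smul G x), ?_⟩
    have key : ((((Path.refl x).cast rfl (one_smul G x)).map
        (continuous_mk (G := G) (X := X))).cast rfl (mk_smul_eq (1 : G) x).symm) =
        Path.refl (⟦x⟧ : orbitRel.Quotient G X) := by
      ext t
      rfl
    rw [key]
  | mul g₁ g₂ _ _ ih₁ ih₂ =>
    intro x
    obtain ⟨Δ₂, h₂⟩ := ih₂ x
    obtain ⟨Δ₁, h₁⟩ := ih₁ (g₂ • x)
    refine ⟨(Δ₂.trans Δ₁).cast rfl (mul_smul g₁ g₂ x), ?_⟩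
    have e : (⟦x⟧ : orbitRel.Quotient G X) = ⟦g₂ • x⟧ := (mk_smul_eq g₂ x).symm
    have key : ((((Δ₂.trans Δ₁).cast rfl (mul_smul g₁ g₂ x)).map
        (continuous_mk (G := G) (X := X))).cast rfl (mk_smul_eq (g₁ * g₂) x).symm) =
        ((Δ₂.map (continuous_mk (G := G) (X := X))).cast rfl (mk_smul_eq g₂ x).symm).trans
          (((Δ₁.map (continuous_mk (G := G) (X := X))).cast rfl
            (mk_smul_eq g₁ (g₂ • x)).symm).cast e e) := by
      ext t
      simp only [Path.cast_coe, Path.map_coe, Function.comp_apply, Path.trans_apply]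
      split_ifs with h <;> rfl
    rw [key]
    have h₁' := h₁.pathCast e e
    have hr : (Path.refl (⟦g₂ • x⟧ : orbitRel.Quotient G X)).cast e e = Path.refl ⟦x⟧ := by
      ext t
      exact mk_smul_eq g₂ x
    rw [hr] at h₁'
    exact (h₂.hcomp h₁').trans ⟨Path.Homotopy.reflTrans _⟩
  | inv g _ ih =>
    intro x
    obtain ⟨Δ, hΔ⟩ := ih (g⁻¹ • x)
    refine ⟨Δ.symm.cast (smul_inv_smul g x).symm rfl, ?_⟩
    have e : (⟦x⟧ : orbitRel.Quotient G X) = ⟦g⁻¹ • x⟧ := (mk_smul_eq g⁻¹ x).symm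
    have key : (((Δ.symm.cast (smul_inv_smul g x).symm rfl).map
        (continuous_mk (G := G) (X := X))).cast rfl (mk_smul_eq g⁻¹ x).symm) =
        (((Δ.map (continuous_mk (G := G) (X := X))).cast rfl
          (mk_smul_eq g (g⁻¹ • x)).symm).symm).cast e e := by
      ext t
      rfl
    rw [key]
    have h' := (hΔ.symm₂).pathCast e e
    have hr : ((Path.refl (⟦g⁻¹ • x⟧ : orbitRel.Quotient G X)).symm).cast e e = Path.refl ⟦x⟧ := by
      ext t
      exact mk_smul_eq g⁻¹ x
    rw [hr] at h'
    exact h'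

/-- **Armstrong's theorem, case `H = G`** (Armstrong 1968, Theorem p. 299; Brown 11.5.2 (c) with
11.2.3 and 11.1.4): if a finite group `G` acts by homeomorphisms on a simply connected Hausdorff
space `X` and `G` is generated by elements having a fixed point, then the orbit space `X/G` is
simply connected. Proof: lift two paths with the same endpoints to `X` from one point (path
lifting, `exists_path_lift`); the lifted endpoints differ by some `g ∈ G`; in `X` the second lift
is homotopic to `Δ_g · (g • first lift)` with `Δ_g` from `exists_path_map_homotopic_refl`, and the
image of this homotopy in `X/G` shows the two paths are homotopic.
[cite: Armstrong1968, Theorem (p. 299)] -/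
theorem simplyConnectedSpace_orbitSpace [Finite G] [ContinuousConstSMul G X] [T2Space X]
    [SimplyConnectedSpace X] (hgen : Subgroup.closure {g : G | ∃ x : X, g • x = x} = ⊤) :
    SimplyConnectedSpace (orbitRel.Quotient G X) := by
  rw [simply_connected_iff_paths_homotopic']
  refine ⟨inferInstance, @fun y y' γ₁ γ₂ => ?_⟩
  induction y using Quotient.inductionOn with
  | h x₀ =>
  -- lift both paths from `x₀`
  obtain ⟨x₁, Γ₁, hΓ₁⟩ := exists_path_lift (G := G) γ₁
  obtain ⟨x₂, Γ₂, hΓ₂⟩ := exists_path_lift (G := G) γ₂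
  have hx₁ : (⟦x₁⟧ : orbitRel.Quotient G X) = y' := by
    have h := hΓ₁ 1
    rwa [Γ₁.target, γ₁.target] at h
  subst hx₁
  have hx₂ : (⟦x₂⟧ : orbitRel.Quotient G X) = ⟦x₁⟧ := by
    have h := hΓ₂ 1
    rwa [Γ₂.target, γ₂.target] at h
  obtain ⟨g, rfl⟩ := (mk_eq_mk_iff x₂ x₁).1 hx₂
  -- the comparison loop for `g`
  obtain ⟨Δ, hΔ⟩ := exists_path_map_homotopic_refl (X := X)
    (hgen.symm ▸ Subgroup.mem_top g : g ∈ Subgroup.closure {g : G | ∃ x : X, g • x = x}) x₀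
  -- in `X`: `Γ₂ ≃ Δ · (g • Γ₁)`
  have hX : Γ₂.Homotopic (Δ.trans (Γ₁.map (continuous_const_smul g))) :=
    SimplyConnectedSpace.paths_homotopic _ _
  -- push down to `X/G` and recast to paths `p x₀ ⟶ p x₁`
  have h : (⟦x₁⟧ : orbitRel.Quotient G X) = ⟦g • x₁⟧ := (mk_smul_eq g x₁).symm
  have h₀ : (⟦x₀⟧ : orbitRel.Quotient G X) = ⟦g • x₀⟧ := (mk_smul_eq g x₀).symm
  have hQ : ((Γ₂.map (continuous_mk (G := G) (X := X))).cast rfl h).Homotopic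
      (((Δ.trans (Γ₁.map (continuous_const_smul g))).map
        (continuous_mk (G := G) (X := X))).cast rfl h) :=
    (hX.map ⟨_, continuous_mk (G := G) (X := X)⟩).pathCast rfl h
  have e₂ : (Γ₂.map (continuous_mk (G := G) (X := X))).cast rfl h = γ₂ := by
    ext t
    exact hΓ₂ t
  have e₃ : ((Δ.trans (Γ₁.map (continuous_const_smul g))).map
      (continuous_mk (G := G) (X := X))).cast rfl h =
      ((Δ.map (continuous_mk (G := G) (X := X))).cast rfl h₀).trans γ₁ := by
    ext t
    simp only [Path.cast_coe, Path.map_coe, Function.comp_apply, Path.trans_apply]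
    split_ifs with ht
    · rfl
    · exact (mk_smul_eq g _).trans (hΓ₁ _)
  rw [e₂, e₃] at hQ
  exact (hQ.trans ((hΔ.hcomp (Path.Homotopic.refl γ₁)).trans ⟨Path.Homotopy.reflTrans γ₁⟩)).symm

end OrbitSpaceFundamentalGroup

/-- **Discharge of `armstrong1968_orbitSpace_simplyConnected`** (Armstrong 1968, Theorem p. 299,
the case `H = G`): for a finite group `G` acting by homeomorphisms on a simply connected, locally
compact metric space `X` and generated by elements with fixed points, `X/G` is simply connected —
by `OrbitSpaceFundamentalGroup.simplyConnectedSpace_orbitSpace` (which needs only `X` Hausdorff).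
[cite: Armstrong1968, Theorem (p. 299)] -/
theorem armstrong1968_orbitSpace_simplyConnected_holds :
    armstrong1968_orbitSpace_simplyConnected := by
  intro G X _ _ _ _ _ _ _ hgen
  exact OrbitSpaceFundamentalGroup.simplyConnectedSpace_orbitSpace hgen

end Literature.AlgebraicTopology.FundamentalGroup
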